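import Summits.QuantumFields.BalabanUV.T4Continuum.Support.ShellMeasureMinimiserBonds

/-!
# `T4Continuum.ShellMeasureLandauFixedPoint` — SM-L1's Landau correction `D` MADE KERNEL along the contraction ray:
# the (Ψ-an) binder of row S14 discharged to (44) + (46) TYPE by `B13Contraction113` (Sect. C scheme, in the tree)
# (cell `pub-balaban`, sub-cell `t4`, spine estimate NE7c (node U5b); NE7c formalisation swarm, crew seat
# `b2b-balaban-t4-ne7c-formalise-leaf-02` gen 2; continues this lineage's FINDING F-ne7cleaf02-1 / locator S18 (γ);
# imports `ShellMeasureMinimiserBonds` (row S14 v1, p208432 — hence `B11Prop6Scheme`, `B13Contraction113`,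
# `ShellMeasureLevelAssembly`) ONLY; 0 `def`, 0 sorry)

HONEST FRAMING.  Finite four-torus programme, rung (B)+1 only — NOT infinite volume, NOT a mass gap, NOT the Clay
problem, NOT summit progress; (B), `BetaPertHyp`, (B^μ) not consumed.  NE7c (`T4IndicatorShell.ShellWeightBound`) is
NOT PRINTED and NOT PROVED; «NE7c ⇐ the named binders».  Row S14 (`ShellMeasureMinimiserBonds`) re-sourced END-II's
SM-L1 = (AN-bound)_j witness to B11 Prop. 6's contraction scheme; this lineage's FINDING F-ne7cleaf02-1 observed that
print's bond variables are read-outs of the LANDAU EXPONENT `Ψ(Y) = Y − HD(Y)` ([Balaban1985Variational] (47), (112),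
(174)), `D` the NONLINEAR map of Sect. C — the fixed point of (50) «X → C_j(LʲηA′ − LʲηHX)» — so that S14 v1.1 threads
an abstract holomorphic `Ψ` (binder (Ψ-an), Fréchet form).  HERE `D` IS NOT A BINDER: along the holomorphic solution
curve `σ ↦ Y_σ = X_σ + 𝔄_σ` of S14 §1 the correction `σ ↦ D(Y_σ)` is CONSTRUCTED as the fixed point of (50) by the
tree's kernel theorem `B13Contraction113.analytic_fixedPoint_113` (unit b2b-balaban-b13-g5: the Sect. C [15] scheme
(50)–(55) over abstract complex Banach spaces — self-map (52), the Cauchy-step contraction (53)–(54), Banach's fixed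
point, the nested-balls bound (55), analyticity in one complex parameter by locally uniform limits), from HYPOTHESES of
EARLIER-PAPER TYPE only:
* (44) «|C_j(LʲηA)| ≦ C₂(Lʲη)²|A|²» ([4] = B7 Prop. 4; complex form Prop. 7) — TYPE `‖C Z‖ ≤ C₂‖Z‖²` on `‖Z‖ < R`
  together with `DifferentiableOn ℂ C (ball 0 R)` (Fréchet; on the finite lattice = the printed analyticity; it
  implies B13's line-analytic `QuadAnalytic`, `quadAnalytic_of_frechet`);
* (46) «|HB| ≦ B₀(Lʲη)⁻¹|B|, |∇HB| ≦ B₀(Lʲη)⁻²|B| on Ω_j» ([5] = B9 Thm 3.12) — TYPE `‖H X‖ ≤ B₀‖X‖` into the max-normed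
  configuration space `𝒴` of (115) (modelling conventions of `B11Prop6Scheme`, DIVERGENCE D-B11-20), and the scaling
  `ι : 𝒴 → 𝒴'`, `A′ ↦ LʲηA′` on Ω_j, into the sup-normed space on which `C` acts — TYPE `‖ι Y‖ ≤ ‖Y‖`
  (|A′|_{(−1)} ≤ max{|A′|_{(−1)}, |∇A′|_{(−2)}}, a definition);
* the smallness of (54) «contractive if 9C₂B₀ε₃ < 1» at `ε₃ := ε₄ + a` (the size of the ray's configurations) and the
  domain condition `3(ε₄ + a) ≤ R` (B13's located form of «2ε₃», GAPS G-B13-02a) — numeric conditions, DISPLAYED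
  SHAPE, not discharged.
Renders `b2b-balaban-ref1/pages/1985-cmp102-variational-background/…-p009-x2.png`, `…-p010-x2.png` (pp. 285–286,
(43)–(57)) READ AS IMAGES by this seat.  CONSEQUENCES (kernel): §1 `landauCorrection_along` — a holomorphic
`σ ↦ D_σ` on the disc with `C(ι Y_σ − ι H D_σ) = D_σ`, unique in the ball `‖X‖ ≤ 4C₂(ε₄+a)²`, `‖D_σ‖ ≤ 4C₂‖ι Y_σ‖²`
((55) literally, `‖ι ·‖` = |·|_{(−1)}), `D_0 = 0`; §2 `bondFn_landau_along` — the bond read-out `σ ↦ ℓ(Y_σ − H D_σ)` of the Landau exponent is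
holomorphic on the disc, bounded by `κ((ε₄+a) + 4C₂B₀(ε₄+a)²)` ((57)'s shape), zero at `0`; §3
`classifierWitness_landau_along` — END-II's `hAN` witness for a plaquette of such read-outs
(`ShellMeasureLevelAssembly.classifierWitness_of_bondData`), `H_AN = e^{m·κ·((ε₄+a) + 4C₂B₀(ε₄+a)²)} − 1`; §4
`classifierWitness_of_prop6Scheme_sectC` — ONE CALL from B11 Prop. 6's scheme (S14 §1 `solutionFamily_of_prop6Scheme`:
(P2), (P4), (118)/(121), ray data, flat centre) + (44) + (46) + (54)-smallness + read-outs + the holonomy dictionary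
for `Ψ(Y_σ) = Y_σ − H D_σ`, quantified over THE solution family and THE fixed-point family the two schemes produce
(both unique in their balls — instantiable, not vacuity-prone).  AFTER THIS FILE the honest reading of SM-L1 is:
(AN-bound)_j ⇐ (P2) ∧ (P4) ∧ (118)/(121) ∧ (44)+[4] Prop. 7 ∧ (46) ∧ (54)-smallness at ε₄ + a ∧ ray data ((75)/(103),
[6] (1.31)) ∧ read-out + holonomy dictionaries — all DISPLAYED-TYPE or by-reference binders, none discharged; the Landau
correction `D`, its bound (55) and its analyticity ALONG THE RAY are kernel (no (Ψ-an) binder on this road; the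
Fréchet road of S14 v1.1 + `ShellMeasureLandauExponent` §1 remains the alternative).  0 sorry, 0 `def`, no citation of
the audited series as authority (its displays enter as TYPED HYPOTHESES).  HONEST DEPENDENCY (cell): continuum YM on
T⁴ ⇐ BetaPertH ∧ nine spine estimates (0/9 proved); BetaPertH ⇐ (D1) ∧ (D4) ∧ CAP+tail; G-an2-4 gates asym, D1 and
NE2/3/4.
-/

noncomputable section

open Set Metric NormedSpace

namespace Summit.QuantumFields.BalabanUV.T4Continuum.ShellMeasureLandauFixedPoint

open Literature.MathematicalPhysics.QuantumFieldTheory.Balaban1983to89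
open B13Contraction113 (QuadAnalytic analytic_fixedPoint_113)
open B11Prop6Scheme (mapT Prop4Hyp norm_arg_lt)
open ShellMeasureWilsonWords (wordExp)
open ShellMeasureLevelAssembly (classifierWitness_of_bondData)
open ShellMeasureMinimiserBonds (solutionFamily_of_prop6Scheme)

variable {𝒴 𝒴' 𝒳 : Type*} [NormedAddCommGroup 𝒴] [NormedSpace ℂ 𝒴] [NormedAddCommGroup 𝒴'] [NormedSpace ℂ 𝒴']
  [NormedAddCommGroup 𝒳] [NormedSpace ℂ 𝒳]

/-! ## §1 The Landau correction along a holomorphic curve: the fixed point of (50) -/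

omit [NormedSpace ℂ 𝒳] in
/-- (44) + [4] Prop. 7 in FRÉCHET form (quadratic bound on `‖Z‖ < R` and `DifferentiableOn ℂ C (ball 0 R)`) ⟹ B13's
line-analytic hypothesis structure `QuadAnalytic C C₂ R` (cf. `B11Prop6Scheme.Prop4Hyp.quadAnalytic`). [folklore] -/
theorem quadAnalytic_of_frechet [NormedSpace ℂ 𝒳] {C : 𝒴' → 𝒳} {C₂ R : ℝ}
    (hCq : ∀ Z : 𝒴', ‖Z‖ < R → ‖C Z‖ ≤ C₂ * ‖Z‖ ^ 2) (hCd : DifferentiableOn ℂ C (ball 0 R)) :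
    QuadAnalytic C C₂ R where
  quad := hCq
  lineAnalytic P Q := by
    have hline : Differentiable ℂ (fun ζ : ℂ => P + ζ • Q) :=
      (differentiable_const P).add (differentiable_id.smul_const Q)
    exact hCd.comp hline.differentiableOn fun ζ hζ => mem_ball_zero_iff.2 hζ

/-- **THE LANDAU CORRECTION ALONG A HOLOMORPHIC CURVE.**  Data: `C` with (44)-TYPE quadratic bound and Fréchet
analyticity on `ball 0 R`; the scaling `ι` (`‖ι Y‖ ≤ ‖Y‖`) and the operator `H` with (46)-TYPE bound `B₀`; a
holomorphic curve `σ ↦ Y_σ` on the disc `‖σ‖ < Rad` with `‖Y_σ‖ < ε`; the (54)-TYPE smallness `9C₂B₀ε < 1` and the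
domain condition `3ε ≤ R`.  CONCLUSION (`B13Contraction113.analytic_fixedPoint_113` BY NAME): a holomorphic
`σ ↦ D_σ` on the disc, `D_σ` in the closed ball `4C₂ε²`, solving (50) `C(ι Y_σ − ι(H D_σ)) = D_σ`, unique there, with
the bound (55) LITERALLY: `‖D_σ‖ ≤ 4C₂‖ι Y_σ‖²` («≦ 4C₂|A′|²_{(−1)}», `‖ι ·‖` = |·|_{(−1)}). [folklore] -/
theorem landauCorrection_along [CompleteSpace 𝒳] {C : 𝒴' → 𝒳} {C₂ R : ℝ} (hC₂ : 0 ≤ C₂)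
    (hCq : ∀ Z : 𝒴', ‖Z‖ < R → ‖C Z‖ ≤ C₂ * ‖Z‖ ^ 2) (hCd : DifferentiableOn ℂ C (ball 0 R))
    (ι : 𝒴 →L[ℂ] 𝒴') (hι : ∀ Y, ‖ι Y‖ ≤ ‖Y‖) (H : 𝒳 →L[ℂ] 𝒴) {B₀ : ℝ} (hB₀ : 0 ≤ B₀)
    (hH : ∀ X, ‖H X‖ ≤ B₀ * ‖X‖) {ε Rad : ℝ} (hq : 9 * C₂ * B₀ * ε < 1) (hRC : 3 * ε ≤ R)
    {Y : ℂ → 𝒴} (hYd : DifferentiableOn ℂ Y (ball 0 Rad)) (hY : ∀ σ ∈ ball (0 : ℂ) Rad, ‖Y σ‖ < ε) :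
    ∃ Dc : ℂ → 𝒳, DifferentiableOn ℂ Dc (ball 0 Rad) ∧ ∀ σ ∈ ball (0 : ℂ) Rad,
      Dc σ ∈ closedBall (0 : 𝒳) (4 * C₂ * ε ^ 2) ∧ C (ι (Y σ) - ι (H (Dc σ))) = Dc σ ∧
      (∀ X' ∈ closedBall (0 : 𝒳) (4 * C₂ * ε ^ 2), C (ι (Y σ) - ι (H X')) = X' → X' = Dc σ) ∧
      ‖Dc σ‖ ≤ 4 * C₂ * ‖ι (Y σ)‖ ^ 2 := by
  have hHop : ∀ σ ∈ ball (0 : ℂ) Rad, ∀ X : 𝒳, ‖((ι.comp H : 𝒳 →L[ℂ] 𝒴') : 𝒳 →ₗ[ℂ] 𝒴') X‖ ≤ B₀ * ‖X‖ :=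
    fun σ _ X => (hι _).trans (hH X)
  have hA : ∀ σ ∈ ball (0 : ℂ) Rad, ‖ι (Y σ)‖ < ε := fun σ hσ => (hι _).trans_lt (hY σ hσ)
  have han : ∀ g : ℂ → 𝒳, DifferentiableOn ℂ g (ball 0 Rad) →
      MapsTo g (ball (0 : ℂ) Rad) (closedBall (0 : 𝒳) (4 * C₂ * ε ^ 2)) →
      DifferentiableOn ℂ (fun σ => C (ι (Y σ) - ((ι.comp H : 𝒳 →L[ℂ] 𝒴') : 𝒳 →ₗ[ℂ] 𝒴') (g σ)))
        (ball 0 Rad) := by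
    intro g hg hgm
    have hinner : DifferentiableOn ℂ (fun σ => ι (Y σ) - ι (H (g σ))) (ball 0 Rad) :=
      (ι.differentiable.comp_differentiableOn hYd).sub
        ((ι.comp H).differentiable.comp_differentiableOn hg)
    have hinto : MapsTo (fun σ => ι (Y σ) - ι (H (g σ))) (ball (0 : ℂ) Rad) (ball (0 : 𝒴') R) := by
      intro σ hσ
      have hε : 0 < ε := (norm_nonneg _).trans_lt (hY σ hσ)
      have hgσ : ‖g σ‖ ≤ 4 * C₂ * ε ^ 2 := mem_closedBall_zero_iff.1 (hgm hσ)
      have hR2 : 4 * C₂ * B₀ * ε ≤ 1 := by nlinarith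
      have hHg : ‖ι (H (g σ))‖ ≤ ε := by
        calc ‖ι (H (g σ))‖ ≤ B₀ * ‖g σ‖ := (hι _).trans (hH _)
          _ ≤ B₀ * (4 * C₂ * ε ^ 2) := mul_le_mul_of_nonneg_left hgσ hB₀
          _ = (4 * C₂ * B₀ * ε) * ε := by ring
          _ ≤ 1 * ε := mul_le_mul_of_nonneg_right hR2 hε.le
          _ = ε := one_mul ε
      rw [mem_ball_zero_iff]
      calc ‖ι (Y σ) - ι (H (g σ))‖ ≤ ‖ι (Y σ)‖ + ‖ι (H (g σ))‖ := norm_sub_le _ _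
        _ < ε + ε := add_lt_add_of_lt_of_le (hA σ hσ) hHg
        _ ≤ R := by linarith
    exact hCd.comp hinner hinto
  exact analytic_fixedPoint_113 (quadAnalytic_of_frechet hCq hCd) hC₂ hB₀ isOpen_ball
    (Hσ := fun _ => ((ι.comp H : 𝒳 →L[ℂ] 𝒴') : 𝒳 →ₗ[ℂ] 𝒴')) (Aσ := fun σ => ι (Y σ)) hHop hA hq hRC han

omit [NormedSpace ℂ 𝒴'] [NormedSpace ℂ 𝒳] in
/-- second order ⟹ flat centre: the bound (55) `‖D_σ‖ ≤ 4C₂‖Z_σ‖²` along a curve with `Z_0 = 0` gives `D_0 = 0`.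
[folklore] -/
theorem landauCorrection_zero {C₂ Rad : ℝ} (hRad : 0 < Rad) {Z : ℂ → 𝒴'} {Dc : ℂ → 𝒳} (hZ0 : Z 0 = 0)
    (hbd : ∀ σ ∈ ball (0 : ℂ) Rad, ‖Dc σ‖ ≤ 4 * C₂ * ‖Z σ‖ ^ 2) : Dc 0 = 0 := by
  have h := hbd 0 (mem_ball_self hRad)
  rw [hZ0, norm_zero] at h
  exact norm_le_zero_iff.1 (by simpa using h)

/-! ## §2 Bond read-outs of the Landau exponent `Y_σ − H D_σ` along the curve -/

section ReadOut

variable {A : Type*} [NormedRing A] [NormedAlgebra ℂ A]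

omit [NormedAddCommGroup 𝒴'] [NormedSpace ℂ 𝒴'] in
/-- **A BOND READ-OUT OF THE LANDAU EXPONENT ALONG THE CURVE** `σ ↦ ℓ (Y_σ − H D_σ)` (`ℓ : 𝒴 →L[ℂ] A`,
`‖ℓ Y‖ ≤ κ‖Y‖`, the read-out dictionary of (115)/(77)): holomorphic on the disc, bounded by `κ(ε + B₀·4C₂ε²)` there
((57)'s shape «|A| ≦ |A′| + B₀(Lʲη)⁻¹4C₂|A′|²»), and `= 0` at `σ = 0` — the bond datum `(Rad, a_b)` of
`ShellMeasureLevelAssembly.classifierWitness_of_bondData`. [folklore] -/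
theorem bondFn_landau_along (H : 𝒳 →L[ℂ] 𝒴) {B₀ : ℝ} (hB₀ : 0 ≤ B₀) (hH : ∀ X, ‖H X‖ ≤ B₀ * ‖X‖)
    {C₂ ε Rad : ℝ} {Y : ℂ → 𝒴} {Dc : ℂ → 𝒳} (hYd : DifferentiableOn ℂ Y (ball 0 Rad))
    (hY : ∀ σ ∈ ball (0 : ℂ) Rad, ‖Y σ‖ < ε) (hY0 : Y 0 = 0) (hDd : DifferentiableOn ℂ Dc (ball 0 Rad))
    (hDb : ∀ σ ∈ ball (0 : ℂ) Rad, ‖Dc σ‖ ≤ 4 * C₂ * ε ^ 2) (hD0 : Dc 0 = 0)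
    (ℓ : 𝒴 →L[ℂ] A) {κ : ℝ} (hκ : 0 ≤ κ) (hℓ : ∀ Y, ‖ℓ Y‖ ≤ κ * ‖Y‖) :
    DifferentiableOn ℂ (fun σ => ℓ (Y σ - H (Dc σ))) (ball 0 Rad) ∧
      (∀ w ∈ ball (0 : ℂ) Rad, ‖ℓ (Y w - H (Dc w))‖ ≤ κ * (ε + B₀ * (4 * C₂ * ε ^ 2))) ∧
      ℓ (Y 0 - H (Dc 0)) = 0 := by
  refine ⟨ℓ.differentiable.comp_differentiableOn (hYd.sub (H.differentiable.comp_differentiableOn hDd)),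
    fun w hw => ?_, by rw [hY0, hD0, map_zero, sub_zero, map_zero]⟩
  calc ‖ℓ (Y w - H (Dc w))‖ ≤ κ * ‖Y w - H (Dc w)‖ := hℓ _
    _ ≤ κ * (ε + B₀ * (4 * C₂ * ε ^ 2)) := by
        refine mul_le_mul_of_nonneg_left ?_ hκ
        calc ‖Y w - H (Dc w)‖ ≤ ‖Y w‖ + ‖H (Dc w)‖ := norm_sub_le _ _
          _ ≤ ε + B₀ * (4 * C₂ * ε ^ 2) :=
              add_le_add (hY w hw).le ((hH _).trans (mul_le_mul_of_nonneg_left (hDb w hw) hB₀))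

/-! ## §3 END-II's `hAN` witness for a plaquette of Landau read-outs along the curve -/

omit [NormedAddCommGroup 𝒴'] [NormedSpace ℂ 𝒴'] in
/-- **THE (AN-bound) WITNESS OF A PLAQUETTE FROM THE CURVE AND ITS LANDAU CORRECTION.**  With the plaquette's bond
read-outs `ℓ₁, …, ℓ_m` and the HOLONOMY DICTIONARY «at a real `c ∈ [0,1]` the holonomy `hol c` is the word of
exponentials of the read-outs of the Landau exponent `Y_c − H D_c`» ((112)/(174)/(176)): END-II's `hAN` witness
`f` — holomorphic on `ball 0 Rad`, `‖f‖ ≤ e^{m·κ(ε + 4C₂B₀ε²)} − 1`, `f 0 = 0`, `f c = hol c − 1`. [folklore] -/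
theorem classifierWitness_landau_along [CompleteSpace A] (H : 𝒳 →L[ℂ] 𝒴) {B₀ : ℝ} (hB₀ : 0 ≤ B₀)
    (hH : ∀ X, ‖H X‖ ≤ B₀ * ‖X‖) {C₂ ε Rad : ℝ} {Y : ℂ → 𝒴} {Dc : ℂ → 𝒳}
    (hYd : DifferentiableOn ℂ Y (ball 0 Rad)) (hY : ∀ σ ∈ ball (0 : ℂ) Rad, ‖Y σ‖ < ε) (hY0 : Y 0 = 0)
    (hDd : DifferentiableOn ℂ Dc (ball 0 Rad)) (hDb : ∀ σ ∈ ball (0 : ℂ) Rad, ‖Dc σ‖ ≤ 4 * C₂ * ε ^ 2)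
    (hD0 : Dc 0 = 0) (ℓs : List (𝒴 →L[ℂ] A)) {κ : ℝ} (hκ : 0 ≤ κ) (hℓ : ∀ ℓ ∈ ℓs, ∀ Y, ‖ℓ Y‖ ≤ κ * ‖Y‖)
    {hol : ℝ → A}
    (hhol : ∀ c : ℝ, 0 ≤ c → c ≤ 1 → hol c = wordExp (ℓs.map fun ℓ => ℓ (Y (c : ℂ) - H (Dc (c : ℂ))))) :
    ∃ f : ℂ → A, DifferentiableOn ℂ f (ball 0 Rad) ∧
      (∀ w ∈ ball (0 : ℂ) Rad, ‖f w‖ ≤ Real.exp (ℓs.length * (κ * (ε + B₀ * (4 * C₂ * ε ^ 2)))) - 1) ∧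
      f 0 = 0 ∧ ∀ c : ℝ, 0 ≤ c → c ≤ 1 → f (c : ℂ) = hol c - 1 := by
  have key := fun ℓ (hℓm : ℓ ∈ ℓs) =>
    bondFn_landau_along H hB₀ hH hYd hY hY0 hDd hDb hD0 ℓ hκ (hℓ ℓ hℓm)
  have hd : ∀ Xb ∈ ℓs.map (fun ℓ => fun σ => ℓ (Y σ - H (Dc σ))), DifferentiableOn ℂ Xb (ball 0 Rad) := by
    intro Xb hXb
    obtain ⟨ℓ, hℓm, rfl⟩ := List.mem_map.1 hXb
    exact (key ℓ hℓm).1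
  have hb : ∀ Xb ∈ ℓs.map (fun ℓ => fun σ => ℓ (Y σ - H (Dc σ))), ∀ w ∈ ball (0 : ℂ) Rad,
      ‖Xb w‖ ≤ κ * (ε + B₀ * (4 * C₂ * ε ^ 2)) := by
    intro Xb hXb
    obtain ⟨ℓ, hℓm, rfl⟩ := List.mem_map.1 hXb
    exact (key ℓ hℓm).2.1
  have h0 : ∀ Xb ∈ ℓs.map (fun ℓ => fun σ => ℓ (Y σ - H (Dc σ))), Xb 0 = 0 := by
    intro Xb hXb
    obtain ⟨ℓ, hℓm, rfl⟩ := List.mem_map.1 hXb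
    exact (key ℓ hℓm).2.2
  have h := classifierWitness_of_bondData (Xs := ℓs.map (fun ℓ => fun σ => ℓ (Y σ - H (Dc σ)))) hd hb h0
    (hol := hol) (fun c hc0 hc1 => by rw [hhol c hc0 hc1, List.map_map]; rfl)
  rwa [List.length_map] at h

end ReadOut

/-! ## §4 One call from B11 Prop. 6's scheme + Sect. C's scheme -/

section Composite

variable {𝒵 A : Type*} [NormedAddCommGroup 𝒵] [NormedSpace ℂ 𝒵] [NormedRing A] [NormedAlgebra ℂ A]
  [CompleteSpace A] [CompleteSpace 𝒴] [CompleteSpace 𝒳]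
  {𝒢 : 𝒵 →L[ℂ] 𝒴} {Λ : 𝒴 →L[ℂ] 𝒴} {W : 𝒴 → 𝒵} {B₀ θ C₄ a₃ : ℝ}

/-- **SM-L1 FROM B11 PROP. 6's SCHEME AND SECT. C's SCHEME, ONE CALL.**  Binders, all of DISPLAYED TYPE: (P2) `h𝒢`,
`hΛ`; (P4) `hW`; the numbers (118)/(121) (`hdom`, `hself`, `hcontr`); the holomorphic ray data `Jf`, `𝔄f` on the disc
`‖σ‖ < Rad` with bounds `j`, `a` and a flat centre; (44)+[4] Prop. 7 `hCq`/`hCd` on `ball 0 R`; the scaling `hι`;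
(46) `hH`; the (54)-smallness `9C₂B₀(ε₄ + a) < 1` and `3(ε₄ + a) ≤ R`; the read-outs `ℓs` (`‖ℓ Y‖ ≤ κ‖Y‖`); the
HOLONOMY DICTIONARY `hhol` — for THE solution family `X` of the Prop. 6 scheme (unique in `‖X‖ ≤ ε₄`) and THE
fixed-point family `D` of (50) along `Y = X + 𝔄f` (unique in `‖·‖ ≤ 4C₂(ε₄+a)²`), the plaquette holonomy at a real
`c ∈ [0,1]` is the word of exponentials of the read-outs of `Y_c − H D_c`.  CONCLUSION: END-II's `hAN` witness with
`(Rad, H_AN = e^{m·κ·((ε₄+a) + 4C₂B₀(ε₄+a)²)} − 1)`.  The Landau correction is CONSTRUCTED (kernel), not assumed.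
[folklore] -/
theorem classifierWitness_of_prop6Scheme_sectC (h𝒢 : ∀ f, ‖𝒢 f‖ ≤ B₀ * ‖f‖) (hΛ : ∀ Y, ‖Λ Y‖ ≤ θ * ‖Y‖)
    (hW : Prop4Hyp W C₄ a₃) (hB₀ : 0 ≤ B₀) (hC₄ : 0 ≤ C₄) (hθ : 0 ≤ θ) {j a ε₄ : ℝ} (hε₄ : 0 ≤ ε₄)
    (hdom : 2 * (ε₄ + a) ≤ a₃) (hself : B₀ * j + θ * (ε₄ + a) + B₀ * C₄ * (ε₄ + a) ^ 2 ≤ ε₄)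
    (hcontr : θ + 4 * B₀ * C₄ * (ε₄ + a) < 1) {Rad : ℝ} (hRad : 0 < Rad) {Jf : ℂ → 𝒵} {𝔄f : ℂ → 𝒴}
    (hJd : DifferentiableOn ℂ Jf (ball 0 Rad)) (h𝔄d : DifferentiableOn ℂ 𝔄f (ball 0 Rad))
    (hJ : ∀ σ ∈ ball (0 : ℂ) Rad, ‖Jf σ‖ ≤ j) (h𝔄 : ∀ σ ∈ ball (0 : ℂ) Rad, ‖𝔄f σ‖ < a)
    (hJ0 : Jf 0 = 0) (h𝔄0 : 𝔄f 0 = 0)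
    {C : 𝒴' → 𝒳} {C₂ R : ℝ} (hC₂ : 0 ≤ C₂) (hCq : ∀ Z : 𝒴', ‖Z‖ < R → ‖C Z‖ ≤ C₂ * ‖Z‖ ^ 2)
    (hCd : DifferentiableOn ℂ C (ball 0 R)) (ι : 𝒴 →L[ℂ] 𝒴') (hι : ∀ Y, ‖ι Y‖ ≤ ‖Y‖) (H : 𝒳 →L[ℂ] 𝒴)
    (hH : ∀ X, ‖H X‖ ≤ B₀ * ‖X‖) (hq : 9 * C₂ * B₀ * (ε₄ + a) < 1) (hRC : 3 * (ε₄ + a) ≤ R)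
    (ℓs : List (𝒴 →L[ℂ] A)) {κ : ℝ} (hκ : 0 ≤ κ) (hℓ : ∀ ℓ ∈ ℓs, ∀ Y, ‖ℓ Y‖ ≤ κ * ‖Y‖) {hol : ℝ → A}
    (hhol : ∀ X : ℂ → 𝒴, (∀ σ ∈ ball (0 : ℂ) Rad, ‖X σ‖ ≤ ε₄ ∧ mapT 𝒢 Λ W (Jf σ) (𝔄f σ) (X σ) = X σ) →
      ∀ D : ℂ → 𝒳, (∀ σ ∈ ball (0 : ℂ) Rad, D σ ∈ closedBall (0 : 𝒳) (4 * C₂ * (ε₄ + a) ^ 2) ∧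
        C (ι (X σ + 𝔄f σ) - ι (H (D σ))) = D σ) →
      ∀ c : ℝ, 0 ≤ c → c ≤ 1 →
        hol c = wordExp (ℓs.map fun ℓ => ℓ ((X (c : ℂ) + 𝔄f (c : ℂ)) - H (D (c : ℂ))))) :
    ∃ f : ℂ → A, DifferentiableOn ℂ f (ball 0 Rad) ∧
      (∀ w ∈ ball (0 : ℂ) Rad, ‖f w‖ ≤
        Real.exp (ℓs.length * (κ * ((ε₄ + a) + B₀ * (4 * C₂ * (ε₄ + a) ^ 2)))) - 1) ∧
      f 0 = 0 ∧ ∀ c : ℝ, 0 ≤ c → c ≤ 1 → f (c : ℂ) = hol c - 1 := by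
  obtain ⟨X, hXd, hX, hX0⟩ := solutionFamily_of_prop6Scheme h𝒢 hΛ hW hB₀ hC₄ hθ hε₄ hdom hself hcontr hRad hJd
    h𝔄d hJ h𝔄 hJ0 h𝔄0
  have hYd : DifferentiableOn ℂ (fun σ => X σ + 𝔄f σ) (ball 0 Rad) := hXd.add h𝔄d
  have hY : ∀ σ ∈ ball (0 : ℂ) Rad, ‖X σ + 𝔄f σ‖ < ε₄ + a := fun σ hσ => norm_arg_lt (h𝔄 σ hσ) (hX σ hσ).1
  have hY0 : (fun σ => X σ + 𝔄f σ) 0 = 0 := by simp [hX0, h𝔄0]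
  obtain ⟨Dc, hDd, hD⟩ := landauCorrection_along hC₂ hCq hCd ι hι H hB₀ hH hq hRC hYd hY
  have hDb : ∀ σ ∈ ball (0 : ℂ) Rad, ‖Dc σ‖ ≤ 4 * C₂ * (ε₄ + a) ^ 2 := fun σ hσ =>
    mem_closedBall_zero_iff.1 (hD σ hσ).1
  have hD0 : Dc 0 = 0 := landauCorrection_zero hRad (Z := fun σ => ι (X σ + 𝔄f σ)) (by simp [hX0, h𝔄0])
    fun σ hσ => (hD σ hσ).2.2.2
  exact classifierWitness_landau_along H hB₀ hH hYd hY hY0 hDd hDb hD0 ℓs hκ hℓ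
    (hhol X (fun σ hσ => ⟨(hX σ hσ).1, (hX σ hσ).2.1⟩) Dc (fun σ hσ => ⟨(hD σ hσ).1, (hD σ hσ).2.1⟩))

end Composite

end Summit.QuantumFields.BalabanUV.T4Continuum.ShellMeasureLandauFixedPoint
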